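import Summits.PneNP.PneNP.Theses.TwoTones

/-!
# Refutation of `TwoTones.FrustrationGap` (stmt-PneNP-2222)

`FrustrationGap` claims EXTENSIVE ×2×3 frustration for the phases `(1/2, 1/4)`:
`∃ c > 0, ∃ N₀, ∀ N ≥ N₀, δ_N ≥ δ₂(N) + δ₃(N) + c·N`, with
`δ_N = inf_{x ∈ [0,1]} ∑_{n<N} (‖2ⁿx + 1/2‖ + ‖3ⁿx + 1/4‖)` and `δ₂, δ₃` the one-tone infima
(`‖t‖ = |t - round t|`). It is FALSE. The point `x* = 13/24 = 2/3 + 7/8 - 1` has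
`2ⁿx* ∈ {1/3, 2/3} + ℤ` for `n ≥ 3` and `3ⁿx* ∈ {5/8, 7/8} + ℤ` for `n ≥ 1` (the 2-adic and 3-adic
tails decouple), so both tones sit on their one-tone ground orbits simultaneously and
`δ_N ≤ D_N(13/24) ≤ 7N/24 + 3`; the sub-actions `u₂ = |‖y‖ - 1/3| = dist(y, {1/3,2/3} + ℤ)` and
`u₃ = |‖y + 1/4‖ - 1/8| = dist(y, {5/8,7/8} + ℤ)` certify `δ₂(N) ≥ N/6 - 1/2`, `δ₃(N) ≥ N/8 - 1/4`
(telescoping `‖y + 1/2‖ - 1/6 ≥ u₂(y) - u₂(2y)` and `‖y + 1/4‖ - 1/8 ≥ (u₃(y) - u₃(3y))/2`, checked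
piecewise-linearly on one period). Hence the gap is `≤ 15/4` for all `N ≥ 3`, never `≥ c·N`.
Witness `x* = 13/24`; against `c, N₀` take `N = max (max N₀ 3) ⌈5/c⌉₊`. [folklore]
-/

namespace Summit.PneNP.PneNP.Theorems

set_option maxHeartbeats 2000000 in
open Finset in
/-- Refutes `TwoTones.FrustrationGap`: with `x* = 13/24` both tones are simultaneously on their
one-tone ground orbits (`2ⁿx* ∈ {1/3,2/3}+ℤ` for `n ≥ 3`, `3ⁿx* ∈ {5/8,7/8}+ℤ` for `n ≥ 1`), so
`δ_N ≤ 7N/24 + 3`, while the sub-actions `dist(·,{1/3,2/3}+ℤ)`, `½·dist(·,{5/8,7/8}+ℤ)` give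
`δ₂(N) ≥ N/6 - 1/2` and `δ₃(N) ≥ N/8 - 1/4` over ALL real `x`; hence
`δ_N - δ₂(N) - δ₃(N) ≤ 15/4` for every `N ≥ 3`, contradicting `≥ c·N`.
Witness `x* = 13/24`, `N = max (max N₀ 3) ⌈5/c⌉₊`. [folklore] -/
theorem TwoTonesFrustrationGap_refuted : ¬ Summit.PneNP.PneNP.Theses.TwoTones.FrustrationGap := by
  -- (1) `‖t‖` on half-unit intervals: `t - k` on `[k, k + 1/2]`, `k - t` on `[k - 1/2, k]`
  have dZ_eq_sub : ∀ (k : ℤ) (c t : ℝ), (k : ℝ) = c → c ≤ t → t ≤ c + 1 / 2 →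
      |t - round t| = t - c := by
    intro k c t hc h1 h2
    subst hc
    rw [abs_sub_round_eq_min]
    have hf : Int.fract t = t - k := by
      rw [Int.fract_eq_iff]
      exact ⟨by linarith, by linarith, k, by ring⟩
    rw [hf]
    exact min_eq_left (by linarith)
  have dZ_eq_sub' : ∀ (k : ℤ) (c t : ℝ), (k : ℝ) = c → c - 1 / 2 ≤ t → t ≤ c →
      |t - round t| = c - t := by
    intro k c t hc h1 h2
    subst hc
    rw [abs_sub_round_eq_min]
    rcases eq_or_lt_of_le h2 with h | h
    · rw [h, Int.fract_intCast]; simp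
    · have hf : Int.fract t = t - k + 1 := by
        rw [Int.fract_eq_iff]
        exact ⟨by linarith, by linarith, k - 1, by push_cast; ring⟩
      rw [hf, min_eq_right (by linarith)]
      ring
  -- (2) periodicity of `‖·‖`
  have shift : ∀ (z : ℤ) (t s : ℝ), t = s + z → |t - round t| = |s - round s| := by
    intro z t s h
    rw [h, round_add_intCast]
    push_cast
    congr 1
    ring
  have shiftN : ∀ (q : ℕ) (t s : ℝ), t = s + q → |t - round t| = |s - round s| :=
    fun q t s h => shift q t s (by simp [h])
  -- (3) sub-action inequality for the binary tone, `u₂ = |‖y‖ - 1/3|`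
  have ineq2 : ∀ y : ℝ, 1 / 6 + |(|y - round y|) - 1 / 3| ≤
      |y + 1 / 2 - round (y + 1 / 2)| + |(|2 * y - round (2 * y)|) - 1 / 3| := by
    intro x
    have hy := Int.fract_add_floor x
    have h0 := Int.fract_nonneg x
    have h1 := Int.fract_lt_one x
    rw [shift ⌊x⌋ x (Int.fract x) (by linarith),
      shift ⌊x⌋ (x + 1 / 2) (Int.fract x + 1 / 2) (by linarith),
      shift (2 * ⌊x⌋) (2 * x) (2 * Int.fract x) (by push_cast; linarith)]
    generalize Int.fract x = y at h0 h1 ⊢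
    rcases le_or_gt y (1 / 4) with hb0 | hb0
    · have e0 : |y + 1 / 2 - round (y + 1 / 2)| = 1 - (y + 1 / 2) :=
        dZ_eq_sub' 1 1 (y + 1 / 2) (by norm_num) (by linarith) (by linarith)
      have e1 : |y - round y| = (y) - 0 :=
        dZ_eq_sub 0 0 (y) (by norm_num) (by linarith) (by linarith)
      have e2 : |2 * y - round (2 * y)| = (2 * y) - 0 :=
        dZ_eq_sub 0 0 (2 * y) (by norm_num) (by linarith) (by linarith)
      rw [e0, e1, e2, abs_eq_max_neg, abs_eq_max_neg, max_def, max_def]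
      split_ifs <;> linarith
    rcases le_or_gt y (1 / 2) with hb1 | hb1
    · have e0 : |y + 1 / 2 - round (y + 1 / 2)| = 1 - (y + 1 / 2) :=
        dZ_eq_sub' 1 1 (y + 1 / 2) (by norm_num) (by linarith) (by linarith)
      have e1 : |y - round y| = (y) - 0 :=
        dZ_eq_sub 0 0 (y) (by norm_num) (by linarith) (by linarith)
      have e2 : |2 * y - round (2 * y)| = 1 - (2 * y) :=
        dZ_eq_sub' 1 1 (2 * y) (by norm_num) (by linarith) (by linarith)
      rw [e0, e1, e2, abs_eq_max_neg, abs_eq_max_neg, max_def, max_def]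
      split_ifs <;> linarith
    rcases le_or_gt y (3 / 4) with hb2 | hb2
    · have e0 : |y + 1 / 2 - round (y + 1 / 2)| = (y + 1 / 2) - 1 :=
        dZ_eq_sub 1 1 (y + 1 / 2) (by norm_num) (by linarith) (by linarith)
      have e1 : |y - round y| = 1 - (y) :=
        dZ_eq_sub' 1 1 (y) (by norm_num) (by linarith) (by linarith)
      have e2 : |2 * y - round (2 * y)| = (2 * y) - 1 :=
        dZ_eq_sub 1 1 (2 * y) (by norm_num) (by linarith) (by linarith)
      rw [e0, e1, e2, abs_eq_max_neg, abs_eq_max_neg, max_def, max_def]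
      split_ifs <;> linarith
    have e0 : |y + 1 / 2 - round (y + 1 / 2)| = (y + 1 / 2) - 1 :=
      dZ_eq_sub 1 1 (y + 1 / 2) (by norm_num) (by linarith) (by linarith)
    have e1 : |y - round y| = 1 - (y) :=
      dZ_eq_sub' 1 1 (y) (by norm_num) (by linarith) (by linarith)
    have e2 : |2 * y - round (2 * y)| = 2 - (2 * y) :=
      dZ_eq_sub' 2 2 (2 * y) (by norm_num) (by linarith) (by linarith)
    rw [e0, e1, e2, abs_eq_max_neg, abs_eq_max_neg, max_def, max_def]
    split_ifs <;> linarith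
  -- (4) sub-action inequality for the ternary tone, `u₃ = |‖y + 1/4‖ - 1/8|`
  have ineq3 : ∀ y : ℝ, 1 / 8 + |(|y + 1 / 4 - round (y + 1 / 4)|) - 1 / 8| / 2 ≤
      |y + 1 / 4 - round (y + 1 / 4)| + |(|3 * y + 1 / 4 - round (3 * y + 1 / 4)|) - 1 / 8| / 2 := by
    intro x
    have hy := Int.fract_add_floor x
    have h0 := Int.fract_nonneg x
    have h1 := Int.fract_lt_one x
    rw [shift ⌊x⌋ (x + 1 / 4) (Int.fract x + 1 / 4) (by linarith),
      shift (3 * ⌊x⌋) (3 * x + 1 / 4) (3 * Int.fract x + 1 / 4) (by push_cast; linarith)]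
    generalize Int.fract x = y at h0 h1 ⊢
    rcases le_or_gt y (1 / 12) with hb0 | hb0
    · have e0 : |y + 1 / 4 - round (y + 1 / 4)| = (y + 1 / 4) - 0 :=
        dZ_eq_sub 0 0 (y + 1 / 4) (by norm_num) (by linarith) (by linarith)
      have e1 : |3 * y + 1 / 4 - round (3 * y + 1 / 4)| = (3 * y + 1 / 4) - 0 :=
        dZ_eq_sub 0 0 (3 * y + 1 / 4) (by norm_num) (by linarith) (by linarith)
      rw [e0, e1, abs_eq_max_neg, abs_eq_max_neg, max_def, max_def]
      split_ifs <;> linarith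
    rcases le_or_gt y (1 / 4) with hb1 | hb1
    · have e0 : |y + 1 / 4 - round (y + 1 / 4)| = (y + 1 / 4) - 0 :=
        dZ_eq_sub 0 0 (y + 1 / 4) (by norm_num) (by linarith) (by linarith)
      have e1 : |3 * y + 1 / 4 - round (3 * y + 1 / 4)| = 1 - (3 * y + 1 / 4) :=
        dZ_eq_sub' 1 1 (3 * y + 1 / 4) (by norm_num) (by linarith) (by linarith)
      rw [e0, e1, abs_eq_max_neg, abs_eq_max_neg, max_def, max_def]
      split_ifs <;> linarith
    rcases le_or_gt y (5 / 12) with hb2 | hb2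
    · have e0 : |y + 1 / 4 - round (y + 1 / 4)| = 1 - (y + 1 / 4) :=
        dZ_eq_sub' 1 1 (y + 1 / 4) (by norm_num) (by linarith) (by linarith)
      have e1 : |3 * y + 1 / 4 - round (3 * y + 1 / 4)| = (3 * y + 1 / 4) - 1 :=
        dZ_eq_sub 1 1 (3 * y + 1 / 4) (by norm_num) (by linarith) (by linarith)
      rw [e0, e1, abs_eq_max_neg, abs_eq_max_neg, max_def, max_def]
      split_ifs <;> linarith
    rcases le_or_gt y (7 / 12) with hb3 | hb3
    · have e0 : |y + 1 / 4 - round (y + 1 / 4)| = 1 - (y + 1 / 4) :=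
        dZ_eq_sub' 1 1 (y + 1 / 4) (by norm_num) (by linarith) (by linarith)
      have e1 : |3 * y + 1 / 4 - round (3 * y + 1 / 4)| = 2 - (3 * y + 1 / 4) :=
        dZ_eq_sub' 2 2 (3 * y + 1 / 4) (by norm_num) (by linarith) (by linarith)
      rw [e0, e1, abs_eq_max_neg, abs_eq_max_neg, max_def, max_def]
      split_ifs <;> linarith
    rcases le_or_gt y (3 / 4) with hb4 | hb4
    · have e0 : |y + 1 / 4 - round (y + 1 / 4)| = 1 - (y + 1 / 4) :=
        dZ_eq_sub' 1 1 (y + 1 / 4) (by norm_num) (by linarith) (by linarith)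
      have e1 : |3 * y + 1 / 4 - round (3 * y + 1 / 4)| = (3 * y + 1 / 4) - 2 :=
        dZ_eq_sub 2 2 (3 * y + 1 / 4) (by norm_num) (by linarith) (by linarith)
      rw [e0, e1, abs_eq_max_neg, abs_eq_max_neg, max_def, max_def]
      split_ifs <;> linarith
    rcases le_or_gt y (11 / 12) with hb5 | hb5
    · have e0 : |y + 1 / 4 - round (y + 1 / 4)| = (y + 1 / 4) - 1 :=
        dZ_eq_sub 1 1 (y + 1 / 4) (by norm_num) (by linarith) (by linarith)
      have e1 : |3 * y + 1 / 4 - round (3 * y + 1 / 4)| = 3 - (3 * y + 1 / 4) :=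
        dZ_eq_sub' 3 3 (3 * y + 1 / 4) (by norm_num) (by linarith) (by linarith)
      rw [e0, e1, abs_eq_max_neg, abs_eq_max_neg, max_def, max_def]
      split_ifs <;> linarith
    have e0 : |y + 1 / 4 - round (y + 1 / 4)| = (y + 1 / 4) - 1 :=
      dZ_eq_sub 1 1 (y + 1 / 4) (by norm_num) (by linarith) (by linarith)
    have e1 : |3 * y + 1 / 4 - round (3 * y + 1 / 4)| = (3 * y + 1 / 4) - 3 :=
      dZ_eq_sub 3 3 (3 * y + 1 / 4) (by norm_num) (by linarith) (by linarith)
    rw [e0, e1, abs_eq_max_neg, abs_eq_max_neg, max_def, max_def]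
    split_ifs <;> linarith
  -- (5) telescoping: one-tone lower bounds for EVERY real starting point
  have sum2 : ∀ (x : ℝ) (N : ℕ), (N : ℝ) / 6 + |(|x - round x|) - 1 / 3| ≤
      (∑ n ∈ Finset.range N, |2 ^ n * x + 1 / 2 - round (2 ^ n * x + 1 / 2)|) +
        |(|2 ^ N * x - round (2 ^ N * x)|) - 1 / 3| := by
    intro x N
    induction N with
    | zero => simp
    | succ N ih =>
      rw [Finset.sum_range_succ]
      have h := ineq2 (2 ^ N * x)
      have e : (2 : ℝ) ^ (N + 1) * x = 2 * (2 ^ N * x) := by rw [pow_succ]; ring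
      rw [e]
      push_cast
      linarith
  have sum3 : ∀ (x : ℝ) (N : ℕ), (N : ℝ) / 8 + |(|x + 1 / 4 - round (x + 1 / 4)|) - 1 / 8| / 2 ≤
      (∑ n ∈ Finset.range N, |3 ^ n * x + 1 / 4 - round (3 ^ n * x + 1 / 4)|) +
        |(|3 ^ N * x + 1 / 4 - round (3 ^ N * x + 1 / 4)|) - 1 / 8| / 2 := by
    intro x N
    induction N with
    | zero => simp
    | succ N ih =>
      rw [Finset.sum_range_succ]
      have h := ineq3 (3 ^ N * x)
      have e : (3 : ℝ) ^ (N + 1) * x = 3 * (3 ^ N * x) := by rw [pow_succ]; ring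
      rw [e]
      push_cast
      linarith
  -- (6) the witness `x* = 13/24`: both tones on their ground orbits for `n ≥ 3`
  have pow2mod : ∀ m : ℕ, 2 ^ m % 3 = 1 ∨ 2 ^ m % 3 = 2 := by
    intro m
    induction m with
    | zero => left; norm_num
    | succ m ih => rw [pow_succ, Nat.mul_mod]; rcases ih with h | h <;> rw [h] <;> omega
  have pow3mod : ∀ m : ℕ, 3 ^ m % 8 = 1 ∨ 3 ^ m % 8 = 3 := by
    intro m
    induction m with
    | zero => left; norm_num
    | succ m ih => rw [pow_succ, Nat.mul_mod]; rcases ih with h | h <;> rw [h] <;> omega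
  have termA : ∀ m : ℕ,
      |2 ^ (m + 3) * (13 / 24 : ℝ) + 1 / 2 - round (2 ^ (m + 3) * (13 / 24 : ℝ) + 1 / 2)| = 1 / 6 := by
    intro m
    have hdiv : 3 * (13 * 2 ^ m / 3) + 13 * 2 ^ m % 3 = 13 * 2 ^ m := Nat.div_add_mod _ 3
    have hmod : 13 * 2 ^ m % 3 = (13 % 3) * (2 ^ m % 3) % 3 := Nat.mul_mod _ _ _
    have e8 : (2 : ℝ) ^ (m + 3) = 2 ^ m * 8 := by rw [pow_add]; norm_num
    rcases pow2mod m with h | h <;> rw [h] at hmod <;> norm_num at hmod <;> rw [hmod] at hdiv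
    · have hc : (3 : ℝ) * ((13 * 2 ^ m / 3 : ℕ) : ℝ) + 1 = 13 * 2 ^ m := by exact_mod_cast hdiv
      rw [shiftN (13 * 2 ^ m / 3) (2 ^ (m + 3) * (13 / 24 : ℝ) + 1 / 2) ((5 : ℝ) / 6)
          (by rw [e8]; linarith),
        dZ_eq_sub' 1 1 ((5 : ℝ) / 6) (by norm_num) (by norm_num) (by norm_num)]
      norm_num
    · have hc : (3 : ℝ) * ((13 * 2 ^ m / 3 : ℕ) : ℝ) + 2 = 13 * 2 ^ m := by exact_mod_cast hdiv
      rw [shiftN (13 * 2 ^ m / 3) (2 ^ (m + 3) * (13 / 24 : ℝ) + 1 / 2) ((7 : ℝ) / 6)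
          (by rw [e8]; linarith),
        dZ_eq_sub 1 1 ((7 : ℝ) / 6) (by norm_num) (by norm_num) (by norm_num)]
      norm_num
  have termB : ∀ m : ℕ,
      |3 ^ (m + 3) * (13 / 24 : ℝ) + 1 / 4 - round (3 ^ (m + 3) * (13 / 24 : ℝ) + 1 / 4)| = 1 / 8 := by
    intro m
    have hdiv : 8 * (117 * 3 ^ m / 8) + 117 * 3 ^ m % 8 = 117 * 3 ^ m := Nat.div_add_mod _ 8
    have hmod : 117 * 3 ^ m % 8 = (117 % 8) * (3 ^ m % 8) % 8 := Nat.mul_mod _ _ _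
    have e27 : (3 : ℝ) ^ (m + 3) = 3 ^ m * 27 := by rw [pow_add]; norm_num
    rcases pow3mod m with h | h <;> rw [h] at hmod <;> norm_num at hmod <;> rw [hmod] at hdiv
    · have hc : (8 : ℝ) * ((117 * 3 ^ m / 8 : ℕ) : ℝ) + 5 = 117 * 3 ^ m := by exact_mod_cast hdiv
      rw [shiftN (117 * 3 ^ m / 8) (3 ^ (m + 3) * (13 / 24 : ℝ) + 1 / 4) ((7 : ℝ) / 8)
          (by rw [e27]; linarith),
        dZ_eq_sub' 1 1 ((7 : ℝ) / 8) (by norm_num) (by norm_num) (by norm_num)]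
      norm_num
    · have hc : (8 : ℝ) * ((117 * 3 ^ m / 8 : ℕ) : ℝ) + 7 = 117 * 3 ^ m := by exact_mod_cast hdiv
      rw [shiftN (117 * 3 ^ m / 8) (3 ^ (m + 3) * (13 / 24 : ℝ) + 1 / 4) ((9 : ℝ) / 8)
          (by rw [e27]; linarith),
        dZ_eq_sub 1 1 ((9 : ℝ) / 8) (by norm_num) (by norm_num) (by norm_num)]
      norm_num
  have upper : ∀ N : ℕ, 3 ≤ N →
      (∑ n ∈ Finset.range N, (|2 ^ n * (13 / 24 : ℝ) + 1 / 2 - round (2 ^ n * (13 / 24 : ℝ) + 1 / 2)| +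
        |3 ^ n * (13 / 24 : ℝ) + 1 / 4 - round (3 ^ n * (13 / 24 : ℝ) + 1 / 4)|)) ≤ 7 * (N : ℝ) / 24 + 3 := by
    intro N hN
    induction N, hN using Nat.le_induction with
    | base =>
      rw [Finset.sum_range_succ, Finset.sum_range_succ, Finset.sum_range_succ, Finset.sum_range_zero]
      have a0 := abs_sub_round (2 ^ 0 * (13 / 24 : ℝ) + 1 / 2)
      have b0 := abs_sub_round (3 ^ 0 * (13 / 24 : ℝ) + 1 / 4)
      have a1 := abs_sub_round (2 ^ 1 * (13 / 24 : ℝ) + 1 / 2)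
      have b1 := abs_sub_round (3 ^ 1 * (13 / 24 : ℝ) + 1 / 4)
      have a2 := abs_sub_round (2 ^ 2 * (13 / 24 : ℝ) + 1 / 2)
      have b2 := abs_sub_round (3 ^ 2 * (13 / 24 : ℝ) + 1 / 4)
      push_cast
      linarith
    | succ N hN ih =>
      rw [Finset.sum_range_succ]
      obtain ⟨m, rfl⟩ : ∃ m, N = m + 3 := ⟨N - 3, by omega⟩
      have hA := termA m
      have hB := termB m
      push_cast at ih ⊢
      linarith
  -- (7) the contradiction
  rintro ⟨c, hc, N₀, h⟩
  have hN3 : 3 ≤ max (max N₀ 3) ⌈5 / c⌉₊ := le_trans (le_max_right _ _) (le_max_left _ _)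
  have hNc : (⌈5 / c⌉₊ : ℝ) ≤ ((max (max N₀ 3) ⌈5 / c⌉₊ : ℕ) : ℝ) := by
    exact_mod_cast le_max_right _ _
  have key := h (max (max N₀ 3) ⌈5 / c⌉₊)
    (le_trans (le_max_left N₀ 3) (le_max_left (max N₀ 3) ⌈5 / c⌉₊))
  generalize max (max N₀ 3) ⌈5 / c⌉₊ = N at hN3 hNc key
  have h5 : 5 ≤ (N : ℝ) * c := (div_le_iff₀ hc).mp (le_trans (Nat.le_ceil _) hNc)
  have hup : sInf ((fun x : ℝ => ∑ n ∈ Finset.range N, (|2 ^ n * x + 1 / 2 - round (2 ^ n * x + 1 / 2)| + |3 ^ n * x + 1 / 4 - round (3 ^ n * x + 1 / 4)|)) '' Set.Icc (0 : ℝ) 1) ≤ 7 * (N : ℝ) / 24 + 3 := by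
    refine le_trans (csInf_le ⟨0, ?_⟩ ⟨13 / 24, ⟨by norm_num, by norm_num⟩, rfl⟩) (upper N hN3)
    rintro _ ⟨x, -, rfl⟩
    exact Finset.sum_nonneg fun n _ => add_nonneg (abs_nonneg _) (abs_nonneg _)
  have hlo2 : (N : ℝ) / 6 - 1 / 2 ≤ sInf ((fun x : ℝ => ∑ n ∈ Finset.range N, |2 ^ n * x + 1 / 2 - round (2 ^ n * x + 1 / 2)|) '' Set.Icc (0 : ℝ) 1) := by
    refine le_csInf ((Set.nonempty_Icc.2 zero_le_one).image _) ?_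
    rintro _ ⟨x, -, rfl⟩
    have h1 := sum2 x N
    have h2 := abs_nonneg ((|x - round x|) - 1 / 3)
    have h3 : |(|2 ^ N * x - round (2 ^ N * x)|) - 1 / 3| ≤ 1 / 2 :=
      abs_le.2 ⟨by linarith [abs_nonneg (2 ^ N * x - round (2 ^ N * x))],
        by linarith [abs_sub_round (2 ^ N * x)]⟩
    show (N : ℝ) / 6 - 1 / 2 ≤ ∑ n ∈ Finset.range N, |2 ^ n * x + 1 / 2 - round (2 ^ n * x + 1 / 2)|
    linarith
  have hlo3 : (N : ℝ) / 8 - 1 / 4 ≤ sInf ((fun x : ℝ => ∑ n ∈ Finset.range N, |3 ^ n * x + 1 / 4 - round (3 ^ n * x + 1 / 4)|) '' Set.Icc (0 : ℝ) 1) := by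
    refine le_csInf ((Set.nonempty_Icc.2 zero_le_one).image _) ?_
    rintro _ ⟨x, -, rfl⟩
    have h1 := sum3 x N
    have h2 := abs_nonneg ((|x + 1 / 4 - round (x + 1 / 4)|) - 1 / 8)
    have h3 : |(|3 ^ N * x + 1 / 4 - round (3 ^ N * x + 1 / 4)|) - 1 / 8| ≤ 1 / 2 :=
      abs_le.2 ⟨by linarith [abs_nonneg (3 ^ N * x + 1 / 4 - round (3 ^ N * x + 1 / 4))],
        by linarith [abs_sub_round (3 ^ N * x + 1 / 4)]⟩
    show (N : ℝ) / 8 - 1 / 4 ≤ ∑ n ∈ Finset.range N, |3 ^ n * x + 1 / 4 - round (3 ^ n * x + 1 / 4)|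
    linarith
  linarith

end Summit.PneNP.PneNP.Theorems
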